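import Literature.Computability.AlgebraicComplexity.BI17SL3InvariantDimensionProofs
import HarnessLib

/-!
# Two identities of the block signs `ζ_e` (Bürgisser–Ikenmeyer 2017, Thm. 5.9 / 5.13 proofs,
# eq. (3.4)) — theorem-only

P. Bürgisser, C. Ikenmeyer, *Fundamental invariants of orbit closures*, J. Algebra **477** (2017)
390–434 = arXiv:1511.02927 [BurgisserIkenmeyer2017]. The block sign `ζ_e` of a word (`wordBlockSign`,
`BI17SL3InvariantDimensionProofs.lean` §9: the coordinate function of `(e_1 ∧ ⋯ ∧ e_N)^{⊗ b}` for a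
block structure `e : [D] ≃ [b] × [N]`) is the word-model form of a product of `b` determinants —
the building block of the tableau invariants `P_T = ∑_{σ_1,…,σ_s ∈ S_m} [∏_j sgn σ_j] ∏_i v(…)`
of BI 2017 eq. (3.4) (L1007). THEOREM-ONLY file (no definitions, no named facts), two pieces of
`ζ_e`-calculus used by the dictionary «`P_T` ↔ wreath average of `ζ_e`» behind Rem. 3.13
(`BI17TableauInvariantsSpanReduction.lean`):

* `sum_prod_sign_mul_ite_eq_wordBlockSign` — **eq. (3.4) read on one word**:
  `∑_{σ : [b] → S_N} (∏_a sgn σ_a) · [w = σ on every block] = ζ_e(w)` (at most one family `σ`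
  matches a word, namely its blocks, and only when every block is a bijection);
* `wordBlockSign_perm_comp` — **renaming the letters** by `ρ ∈ S_N` multiplies `ζ_e` by
  `sgn(ρ)^b` (one `sgn ρ` per block).

Honest framing: bookkeeping identities for the cell `val-lit`; VP ≠ VNP is NOT proved and nothing
here bears on it.

## References

* [BurgisserIkenmeyer2017] P. Bürgisser, C. Ikenmeyer, J. Algebra 477 (2017) 390–434 =
  arXiv:1511.02927, eq. (3.4), Thm. 5.9 (proof of (2)), Thm. 5.13 (proof).
-/

noncomputable section

open Literature.NumberTheory.DiophantineGeometry

namespace Literature.Computability.AlgebraicComplexity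

variable (k : Type*) [Field k] {D b N : ℕ}

/-- For a map `g : [N] → [N]`, `∑_{τ ∈ S_N} sgn(τ) [g = τ]` is `sgn(g)` if `g` is a bijection and `0`
otherwise (at most one permutation has underlying map `g`). [folklore] -/
private theorem sum_sign_mul_ite_coe_eq (g : Fin N → Fin N) :
    ∑ τ : Equiv.Perm (Fin N), ((Equiv.Perm.sign τ : ℤ) : k) * (if g = ⇑τ then 1 else 0) =
      if Function.Bijective g then (((Kumar2015.seqSign g : ℤˣ) : ℤ) : k) else 0 := by
  classical
  by_cases hg : Function.Bijective g
  · rw [if_pos hg, Finset.sum_eq_single (Equiv.ofBijective g hg)]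
    · rw [if_pos (Equiv.coe_ofBijective (f := g) hg).symm, mul_one,
        ← Kumar2015.seqSign_coe_perm (Equiv.ofBijective g hg), Equiv.coe_ofBijective]
    · intro τ _ hτ
      rw [if_neg, mul_zero]
      intro hgτ
      exact hτ (Equiv.ext fun i => (congrFun hgτ i).symm)
    · intro h
      exact absurd (Finset.mem_univ _) h
  · rw [if_neg hg]
    refine Finset.sum_eq_zero fun τ _ => ?_
    rw [if_neg, mul_zero]
    rintro rfl
    exact hg τ.bijective

/-- **BI 2017 eq. (3.4) read on a single word**: for a block structure `e` (`b` blocks of `N`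
positions) and a word `w`, `∑_{σ : [b] → S_N} (∏_a sgn σ_a) · [∀ q, w(q) = σ_{e(q)₁}(e(q)₂)] = ζ_e(w)`
— the signed sum over families of permutations, one per block (one per column of the tableau in
`P_T = ∑_{σ_1,…,σ_s} [∏ sgn σ_j] ∏ v(…)`), collapses to the block sign. [cite: BurgisserIkenmeyer2017, eq. (3.4)] -/
theorem sum_prod_sign_mul_ite_eq_wordBlockSign (e : Fin D ≃ Fin b × Fin N) (w : Word N D) :
    ∑ σ : Fin b → Equiv.Perm (Fin N), (∏ a, ((Equiv.Perm.sign (σ a) : ℤ) : k)) *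
        (if ∀ q, w q = σ (e q).1 (e q).2 then 1 else 0) = wordBlockSign k e w := by
  classical
  -- the matching condition, block by block
  have hcond : ∀ σ : Fin b → Equiv.Perm (Fin N),
      (∀ q, w q = σ (e q).1 (e q).2) ↔ ∀ a, (fun j => w (e.symm (a, j))) = ⇑(σ a) := by
    intro σ
    constructor
    · intro h a
      funext j
      have := h (e.symm (a, j))
      simpa only [Equiv.apply_symm_apply] using this
    · intro h q
      have := congrFun (h (e q).1) (e q).2
      simpa only [Prod.mk.eta, Equiv.symm_apply_apply] using this
  have hstep : ∀ σ : Fin b → Equiv.Perm (Fin N),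
      (∏ a, ((Equiv.Perm.sign (σ a) : ℤ) : k)) * (if ∀ q, w q = σ (e q).1 (e q).2 then 1 else 0) =
        ∏ a, ((Equiv.Perm.sign (σ a) : ℤ) : k) *
          (if (fun j => w (e.symm (a, j))) = ⇑(σ a) then 1 else 0) := by
    intro σ
    rw [Finset.prod_mul_distrib, Fintype.prod_boole]
    by_cases hq : ∀ q, w q = σ (e q).1 (e q).2
    · rw [if_pos hq, if_pos ((hcond σ).mp hq)]
    · rw [if_neg hq, if_neg fun h => hq ((hcond σ).mpr h)]
  rw [Finset.sum_congr rfl fun σ _ => hstep σ]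
  -- exchange `∑_σ ∏_a` into `∏_a ∑_τ`
  have hex := Finset.prod_univ_sum (fun _ : Fin b => (Finset.univ : Finset (Equiv.Perm (Fin N))))
    fun a τ => ((Equiv.Perm.sign τ : ℤ) : k) * (if (fun j => w (e.symm (a, j))) = ⇑τ then 1 else 0)
  rw [Fintype.piFinset_univ] at hex
  rw [← hex, Finset.prod_congr rfl fun a _ => sum_sign_mul_ite_coe_eq k fun j => w (e.symm (a, j)),
    Fintype.prod_ite_zero]
  unfold wordBlockSign
  by_cases hb : ∀ a, Function.Bijective fun j => w (e.symm (a, j))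
  · rw [if_pos hb, if_pos hb]
  · rw [if_neg hb, if_neg hb]

/-- **Renaming the letters multiplies a block sign by `sgn(ρ)^b`**: `ζ_e(ρ ∘ w) = sgn(ρ)^b ζ_e(w)`
for `ρ ∈ S_N` (each of the `b` blocks, a bijection `[N] → [N]` or not, is composed with `ρ`).
[cite: BurgisserIkenmeyer2017, Thm. 5.9 (proof of (2))] -/
theorem wordBlockSign_perm_comp (e : Fin D ≃ Fin b × Fin N) (ρ : Equiv.Perm (Fin N))
    (w : Word N D) :
    wordBlockSign k e (⇑ρ ∘ w) = ((Equiv.Perm.sign ρ : ℤ) : k) ^ b * wordBlockSign k e w := by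
  classical
  unfold wordBlockSign
  have hiff : (∀ a, Function.Bijective fun j => (⇑ρ ∘ w) (e.symm (a, j))) ↔
      ∀ a, Function.Bijective fun j => w (e.symm (a, j)) :=
    forall_congr' fun a => Equiv.comp_bijective (fun j => w (e.symm (a, j))) ρ
  by_cases h : ∀ a, Function.Bijective fun j => w (e.symm (a, j))
  · rw [if_pos (hiff.mpr h), if_pos h]
    have hρ : ∀ a, Kumar2015.seqSign (fun j => (⇑ρ ∘ w) (e.symm (a, j))) =
        Equiv.Perm.sign ρ * Kumar2015.seqSign (fun j => w (e.symm (a, j))) := by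
      intro a
      rw [show (fun j => w (e.symm (a, j))) = ⇑(Equiv.ofBijective _ (h a)) from rfl,
        show (fun j => (⇑ρ ∘ w) (e.symm (a, j))) = ⇑(ρ * Equiv.ofBijective _ (h a)) from rfl,
        Kumar2015.seqSign_coe_perm, Kumar2015.seqSign_coe_perm, Equiv.Perm.sign_mul]
    simp_rw [hρ, Units.val_mul, Int.cast_mul, Finset.prod_mul_distrib, Finset.prod_const,
      Finset.card_univ, Fintype.card_fin]
  · rw [if_neg (fun h' => h (hiff.mp h')), if_neg h, mul_zero]

end Literature.Computability.AlgebraicComplexity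

end
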